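import Summits.CriticalPhenomena.PercolationContinuityZ3.Theorems.Transplant.SkelSignClosureCentred
import Summits.CriticalPhenomena.PercolationContinuityZ3.Theorems.Transplant.SkelPhiFaceResidueO
import Summits.CriticalPhenomena.PercolationContinuityZ3.Theorems.Transplant.SkelPhiFaceResidue
import Summits.CriticalPhenomena.PercolationContinuityZ3.Theorems.Transplant.SkelPhiCellsConcGLevels
import Summits.CriticalPhenomena.PercolationContinuityZ3.Theorems.Transplant.SkelChainUP
import Summits.CriticalPhenomena.PercolationContinuityZ3.Theorems.Transplant.KNCellsSchemeO
import Summits.CriticalPhenomena.PercolationContinuityZ3.Theorems.Transplant.KNCellsProcessO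
import Summits.CriticalPhenomena.PercolationContinuityZ3.Theorems.Transplant.KNCellsRunO
import Summits.CriticalPhenomena.PercolationContinuityZ3.Theorems.Transplant.KNCellsRunInvO
import Summits.CriticalPhenomena.PercolationContinuityZ3.Theorems.Transplant.KNCells2SchemeO
import Summits.CriticalPhenomena.PercolationContinuityZ3.Theorems.Transplant.KNCells2RunO
import Summits.CriticalPhenomena.PercolationContinuityZ3.Theorems.Transplant.KNCells2RunInvO
import Summits.CriticalPhenomena.PercolationContinuityZ3.Theorems.Transplant.KNCellsCoverO
import Summits.CriticalPhenomena.PercolationContinuityZ3.Theorems.Transplant.KNCells2CoverO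
import Summits.CriticalPhenomena.PercolationContinuityZ3.Theorems.Transplant.KNCellsReachO
import Summits.CriticalPhenomena.PercolationContinuityZ3.Theorems.Transplant.KNCells2ReachO
import Summits.CriticalPhenomena.PercolationContinuityZ3.Theorems.Transplant.KNCellsExitO
import Summits.CriticalPhenomena.PercolationContinuityZ3.Theorems.Transplant.KNCells2ExitO
import Summits.CriticalPhenomena.PercolationContinuityZ3.Theorems.Transplant.KNCellsStepsDefsO
import Summits.CriticalPhenomena.PercolationContinuityZ3.Theorems.Transplant.KNCellsStepsReachO
import Summits.CriticalPhenomena.PercolationContinuityZ3.Theorems.Transplant.KNCellsStepsPinO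
import Summits.CriticalPhenomena.PercolationContinuityZ3.Theorems.Transplant.KNCellsStepsSubboxO
import Summits.CriticalPhenomena.PercolationContinuityZ3.Theorems.Transplant.KNCellsStepsChainO
import Summits.CriticalPhenomena.PercolationContinuityZ3.Theorems.Transplant.KNCellsStepsFailO
import Summits.CriticalPhenomena.PercolationContinuityZ3.Theorems.Transplant.KNCells2StepsO
import Summits.CriticalPhenomena.PercolationContinuityZ3.Theorems.Transplant.KNCells2FailO
import Summits.CriticalPhenomena.PercolationContinuityZ3.Theorems.Transplant.KNCells2FacePrefixO
import Summits.CriticalPhenomena.PercolationContinuityZ3.Theorems.Transplant.KNCells2ThetaPosChosenO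
import Summits.CriticalPhenomena.PercolationContinuityZ3.Theorems.Transplant.KNCells2AnchorNormO
import Summits.CriticalPhenomena.PercolationContinuityZ3.Theorems.Transplant.KNCells2KitAtRunO
import Summits.CriticalPhenomena.PercolationContinuityZ3.Theorems.Transplant.KNCells2CorridorO
import Summits.CriticalPhenomena.PercolationContinuityZ3.Theorems.Transplant.KNCells2CorridorEdgeO
import Summits.CriticalPhenomena.PercolationContinuityZ3.Theorems.Transplant.KNCells2SepQO
import Summits.CriticalPhenomena.PercolationContinuityZ3.Theorems.Transplant.KNCells2RootChainO
import Summits.CriticalPhenomena.PercolationContinuityZ3.Theorems.Transplant.KNCells2TubeSubO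
import Summits.CriticalPhenomena.PercolationContinuityZ3.Theorems.Transplant.SkelTubeSubO
import Summits.CriticalPhenomena.PercolationContinuityZ3.Theorems.Transplant.SkelWinPackagingO
import Summits.CriticalPhenomena.PercolationContinuityZ3.Theorems.Transplant.SkelKitResiduesO
import Summits.CriticalPhenomena.PercolationContinuityZ3.Theorems.Transplant.SkelSignClosureResidues
import Literature.Probability.Percolation.OrientedHistorySiteRenormalizationRun
import Summits.CriticalPhenomena.PercolationContinuityZ3.Theorems.Transplant.SkelKitResiduesHabN
import HarnessLib

/-!
# N2 (frames-only node `SamePDropOfSkeletonFrm₁`, OPEN) — ORIENTED MACRO LAYER (WAVE 0 (c1), (R-18) `q ≡ true`): the oriented twin of N1's `SkelSignClosureResidues`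

builds on p205010 (kernel theorem, internal audit signed; external expert review pending) — nothing in this file uses p205010; NOTHING is claimed about the
open node `SamePDropOfSkeletonFrm₁` (`SamePDropOfSkeletonNeg₁` is CLOSED in the tree and untouched by this file).
Status sentence (coordinator 2026-08-20T04:30Z): "θ(p_c) = 0 on ℤ^d, all d ≥ 2 — kernel-verified (Lean 4/Mathlib, standard axioms); internal adversarial
audit SIGNED 2026-08-20 04:29Z; external expert review pending."
Lane `prim-bschramm-*`, seat `prim-bschramm-stmt` (gen 19); helper file (`--supports stmt-CriticalPhenomena-4575 --as helper`); N2-SCOPE §20, (R-18)/(R-19).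
PORT RULES (HOME/prim-bschramm-stmt-g19/lean/port_orient.py): the history-site API is replaced by its ORIENTED twin at the fixed quadrant `qNE := fun _ => true`
(`HState.choice ↦ HState.ochoice qNE`, `mstOf ↦ omstOf qNE`, `mst/stN ↦ omst/ostN qNE`, `occFinal ↦ ooccFinal qNE`, `Lawful ↦ OLawful qNE`, onward directions
`onward ↦ onwardO` = the POSITIVE ones, (N2-e)); every declaration whose text changes thereby — directly or through a changed declaration — is re-declared with the
suffix `O` (same namespace); unchanged declarations of the N1 file are NOT repeated (the N1 module is imported). Docstrings/citations are N1's.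
N1 HEADER (kept for the reader):
* §1 `Skelφ.δUP G hΔ n ε` / `δUP_pos` / `δUP_le_one` / `δUP_spec` (the accuracy of `SkelConc.chain_edge_subgraph_UP G hΔ n hε` as a function — graph +
  degree bound only), `Skelφ.δC G hΔ ε` (`min` over `n ≤ nmaxC`) / `δC_pos` / `δC_le_one` / `δC_le_δUP` / `δC_spec`;
* §2 **`PlanarSkeletonSign.samePDropOfSkeletonSign_of_concSG_residuesRH (hres) : SamePDropOfSkeletonSign`**.
[cite: KozmaNitzan2024, §4 Theorem 6 (pp. 25–31), (30), (32), Lemmas 10–12; §1 p. 2 (approach 1)] [cite: Hutchcroft2016, Thm. 1]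
-/
noncomputable section

open MeasureTheory ProbabilityTheory
open scoped ENNReal Classical

namespace Summit.CriticalPhenomena.PercolationContinuityZ3.Theorems.Transplant

open Literature.Probability.Percolation Literature.Probability.LatticeModels SimpleGraph KNCells KNLevels
open Literature.Barriers.CriticalPhenomena (HasExponentialGrowth)
open BoxProdZ2 (ConcRadiiG)

/-! ## §1 Chain accuracies as functions of the graph and a degree bound -/

namespace Skelφ

variable {V : Type} [DecidableEq V] [Countable V] (G : SimpleGraph V) [G.LocallyFinite] {Δ : ℕ} (hΔ : ∀ v, G.degree v ≤ Δ)

/-- **Specification of `δUP`** (every `q < 1`, every subgraph `G' ≤ G`, every weighting). [cite: KozmaNitzan2024, §4 Lemma 12 (pp. 23–25)] -/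
theorem δUP_specO (n : ℕ) {ε : ℝ} (hε : 0 < ε) : ((∀ (q : unitInterval), (q : ℝ) < 1 → ∀ (G' : SimpleGraph V) [G'.LocallyFinite], G' ≤ G →
      ∀ (Wt : Sym2 V → unitInterval) (s : Fin (n + 1) → TStep G') (T' : Fin (n + 1) → Finset V) (η : ℝ),
      (∀ i : Fin (n + 1), (s i).L.o = (s 0).L.o) →
      (∀ i : Fin n, T' (Fin.castSucc i) ⊆ (s i.succ).L.X 0) →
      (∀ i : Fin (n + 1), T' i ⊆ (s i).T) →
      (∀ i : Fin (n + 1), (s i).KitsAt Wt q Δ (δUP G hΔ n ε)) →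
      η ≤ δUP G hΔ n ε / 2 →
      (∀ i : Fin (n + 1), (prodBernoulli Wt).real (⋃ t ∈ (s i).T \ T' i, openConn (s 0).L.o t) ≤ η) →
      1 - δUP G hΔ n ε < (prodBernoulli Wt).real (s 0).L.reachB →
        1 - ε < (prodBernoulli Wt).real (⋃ t ∈ T' (Fin.last n), openConn (s 0).L.o t)) : Prop) := by
  have e : δUP G hΔ n ε = Classical.choose (SkelConc.chain_edge_subgraph_UP G hΔ n hε) := by unfold δUP; rw [dif_pos hε]
  rw [e]
  exact (Classical.choose_spec (SkelConc.chain_edge_subgraph_UP G hΔ n hε)).2.2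

/-- **The chain property of every length `n ≤ nmaxC` at the accuracy `δC`**, in every subgraph `G' ≤ G`, for every `q < 1`, delivering `1 − ε`.
[cite: KozmaNitzan2024, §4 Lemma 12 (pp. 23–25)] -/
theorem δC_specO {ε : ℝ} (hε : 0 < ε) {n : ℕ} (hn : n ≤ Skel.nmaxC) {q : unitInterval} (hq1 : (q : ℝ) < 1)
    (G' : SimpleGraph V) [G'.LocallyFinite] (hG' : G' ≤ G) : ((∀ (Wt : Sym2 V → unitInterval) (s : Fin (n + 1) → TStep G') (T' : Fin (n + 1) → Finset V) (η : ℝ),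
      (∀ i : Fin (n + 1), (s i).L.o = (s 0).L.o) →
      (∀ i : Fin n, T' (Fin.castSucc i) ⊆ (s i.succ).L.X 0) →
      (∀ i : Fin (n + 1), T' i ⊆ (s i).T) →
      (∀ i : Fin (n + 1), (s i).KitsAt Wt q Δ (δC G hΔ ε)) →
      η ≤ δC G hΔ ε / 2 →
      (∀ i : Fin (n + 1), (prodBernoulli Wt).real (⋃ t ∈ (s i).T \ T' i, openConn (s 0).L.o t) ≤ η) →
      1 - δC G hΔ ε < (prodBernoulli Wt).real (s 0).L.reachB →
        1 - ε < (prodBernoulli Wt).real (⋃ t ∈ T' (Fin.last n), openConn (s 0).L.o t)) : Prop) := by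
  intro Wt s T' η ho hlink hsub hkits hη hexc hsrc
  have hle := δC_le_δUP G hΔ ε hn
  exact δUP_specO G hΔ n hε q hq1 G' hG' Wt s T' η ho hlink hsub (fun i => (hkits i).mono hle) (hη.trans (by linarith)) hexc
    (by linarith)

end Skelφ

end Summit.CriticalPhenomena.PercolationContinuityZ3.Theorems.Transplant

/-! ## (merged module) the oriented twin `SkelKitResiduesHabNO` — same port rules, header as in part 1 -/
noncomputable section

open MeasureTheory ProbabilityTheory
open scoped ENNReal Classical

namespace Summit.CriticalPhenomena.PercolationContinuityZ3.Theorems.Transplant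

/-! ## §1 The corridor residue with the chain-length bound a parameter -/

namespace Skel

open Literature.Probability.Percolation Literature.Probability.LatticeModels SimpleGraph KNCells
open GadgetSystem ProbeHistory HSiteScheme Contour

variable {V : Type} [DecidableEq V] [Countable V] (G : SimpleGraph V) [G.LocallyFinite]
variable {A : Type*}

/-- **The corridor obligation at one probe `(h, e, a', du)`, habitat form, chain length `≤ nmax`**: for some length `n ≤ nmax` and some finite
habitat `Ω`, a linked chain of `n + 1` target steps in `winGraphIn G Ω` with common source the scheme's root, kits at accuracy `δ` under the
corridor law `S.Wcor`, true targets inside the enlarged ones with excess `≤ η ≤ δ/2`, the arrival cube `M^{aOf₁O}_{tgt e}` inside the first level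
and the last true target inside `M^{a'}_{tgt e + du}` — the body of `Skel.ReachOblAtHO` with `nmaxC` replaced by the parameter `nmax`.
[cite: KozmaNitzan2024, §4 Lemma 12 (pp. 23–25), p. 30 (Step IV)] -/
def ReachOblAtHNO (nmax : ℕ) (S : KSchA V A) (FD : FaceData V A) (Δ' : ℕ) (δ : ℝ) (h : ProbeHistory V) (e : Site 2 × MDir) (a' : A)
    (du : MDir) : Prop :=
  ∃ (n : ℕ) (_ : n ≤ nmax) (Ω : Finset V) (s : Fin (n + 1) → KNLevels.TStep (winGraphIn G Ω)) (T' : Fin (n + 1) → Finset V) (η : ℝ),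
    (∀ i : Fin (n + 1), (s i).L.o = S.Γ.root) ∧
    (∀ i : Fin n, T' (Fin.castSucc i) ⊆ (s i.succ).L.X 0) ∧ (∀ i : Fin (n + 1), T' i ⊆ (s i).T) ∧
    (∀ i : Fin (n + 1), (s i).KitsAt (S.Wcor G FD h e (S.aOf₁O G h e) a' du) S.p Δ' δ) ∧ η ≤ δ / 2 ∧
    (∀ i : Fin (n + 1), (prodBernoulli (S.Wcor G FD h e (S.aOf₁O G h e) a' du)).real (⋃ t ∈ (s i).T \ T' i, openConn S.Γ.root t) ≤ η) ∧
    S.Γ.M (S.aOf₁O G h e) (tgt e) ⊆ (s 0).L.X 0 ∧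
    T' (Fin.last n) ⊆ S.Γ.M a' (tgt e + stepVec du)

/-- **The corridor obligations, run-restricted habitat form, chain length `≤ nmax`**: `ReachOblAtHNO G nmax` for every RUN history whose chosen
candidate is `e`, valid, and every onward direction, at `a' = aOf₂O` — the node-facing (C) residue of N1 at `nmax = nmaxN`.
[cite: KozmaNitzan2024, §4 p. 30 (Step IV), Lemma 12 (pp. 23–25)] -/
def ReachOblRHNO (nmax : ℕ) (S : KSchA V A) (FD : FaceData V A) (Δ' : ℕ) (δ : ℝ) : Prop :=
  ∀ h e, S.IsRun₂O G h → (S.astOf₂O G h).st.ochoice KSchA.qNE = some e → S.Valid₂O G h e →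
    ∀ du ∈ S.onwardO G h (tgt e), ReachOblAtHNO G nmax S FD Δ' δ h e (S.aOf₂O G h e) du

variable {G}
variable {S : KSchA V A} {FD : FaceData V A}
variable {h : ProbeHistory V} {e : Site 2 × MDir} {a' : A} {du : MDir}

omit [Countable V] in
/-- The habitat corridor obligation of record `Skel.ReachOblAtHO` IS `ReachOblAtHNO G nmaxC`. [folklore] -/
theorem reachOblAtH_iff_NO (Δ' : ℕ) (δ : ℝ) :
    ReachOblAtHO G S FD Δ' δ h e a' du ↔ ReachOblAtHNO G nmaxC S FD Δ' δ h e a' du := Iff.rfl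

omit [Countable V] in
/-- The habitat corridor residue of record `Skel.ReachOblRHO` IS `ReachOblRHNO G nmaxC`. [folklore] -/
theorem reachOblRH_iff_NO (Δ' : ℕ) (δ : ℝ) : ReachOblRHO G S FD Δ' δ ↔ ReachOblRHNO G nmaxC S FD Δ' δ := Iff.rfl

omit [Countable V] in
/-- `ReachOblAtHNO` is monotone in the length bound `nmax`. [folklore] -/
theorem ReachOblAtHNO.mono {nmax nmax' : ℕ} (hle : nmax ≤ nmax') {Δ' : ℕ} {δ : ℝ} (hR : ReachOblAtHNO G nmax S FD Δ' δ h e a' du) :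
    ReachOblAtHNO G nmax' S FD Δ' δ h e a' du := by
  obtain ⟨n, hn, Ω, s, T', η, hrest⟩ := hR
  exact ⟨n, hn.trans hle, Ω, s, T', η, hrest⟩

omit [Countable V] in
/-- `ReachOblRHNO` is monotone in the length bound `nmax`. [folklore] -/
theorem ReachOblRHNO.mono {nmax nmax' : ℕ} (hle : nmax ≤ nmax') {Δ' : ℕ} {δ : ℝ} (hR : ReachOblRHNO G nmax S FD Δ' δ) :
    ReachOblRHNO G nmax' S FD Δ' δ :=
  fun h e hrun hc hV du hdu => (hR h e hrun hc hV du hdu).mono hle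

/-- **`ReachOblAtHNO G nmax` + the chain properties of every length `n ≤ nmax` at `(δ ↦ ε'')` in every habitat window graph + `δc ≤ δ` ⟹ the
corridor bound `1 - ε'' < P_{Wfull}(Reach)`** (`KSchA.hreach_of_chain_edge_subO`). [cite: KozmaNitzan2024, §4 Lemma 12 (pp. 23–25), p. 30 (Step IV)] -/
theorem reach_of_reachOblAtHNO {nmax : ℕ} (hV : S.Valid₂O G h e) {Δ' : ℕ} {δ ε'' : ℝ} (hδc : S.δc ≤ δ)
    (hchain : ∀ n ≤ nmax, ∀ (Ω : Finset V) (Wg : Sym2 V → unitInterval) (s : Fin (n + 1) → KNLevels.TStep (winGraphIn G Ω))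
      (T' : Fin (n + 1) → Finset V) (η : ℝ),
      (∀ i : Fin (n + 1), (s i).L.o = (s 0).L.o) →
      (∀ i : Fin n, T' (Fin.castSucc i) ⊆ (s i.succ).L.X 0) →
      (∀ i : Fin (n + 1), T' i ⊆ (s i).T) →
      (∀ i : Fin (n + 1), (s i).KitsAt Wg S.p Δ' δ) →
      η ≤ δ / 2 →
      (∀ i : Fin (n + 1), (prodBernoulli Wg).real (⋃ t ∈ (s i).T \ T' i, openConn (s 0).L.o t) ≤ η) →
      1 - δ < (prodBernoulli Wg).real (s 0).L.reachB →
        1 - ε'' < (prodBernoulli Wg).real (⋃ t ∈ T' (Fin.last n), openConn (s 0).L.o t))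
    (hR : ReachOblAtHNO G nmax S FD Δ' δ h e a' du) :
    1 - ε'' < (prodBernoulli (S.Wfull G h e (S.aOf₁O G h e) a' du)).real (S.Reach G FD h e (S.aOf₁O G h e) a' du) := by
  obtain ⟨n, hn, Ω, s, T', η, ho, hlink, hsub, hkits, hη, hexc, hB0, hTn⟩ := hR
  exact KSchA.hreach_of_chain_edge_subO (winGraphIn G Ω) hV hδc (hchain n hn Ω) s T' ho hlink hsub hkits hη hexc hB0 hTn

end Skel

/-! ## §2 The run-restricted obligations from the three residues, corridor chains of length `≤ nmax` -/

namespace Skelφ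

open Literature.Probability.Percolation Literature.Probability.LatticeModels SimpleGraph KNCells
open GadgetSystem ProbeHistory HSiteScheme Contour
open Skel (winGraph winGraphIn RootOblT RootOblTO ReachOblRHN ReachOblRHNO)

variable {V : Type} [DecidableEq V] [Countable V] {G : SimpleGraph V} [G.LocallyFinite] {φ : V → Site 2}
variable {A : Type*} {S : KSchA V A} {FD : FaceData V A}

/-- **The run-restricted obligations from the named residues, habitat form, corridor chains of length `≤ nmax`** (from `Lip`): `δc ≤ δ`, the
one-step property at `(δ₂ ↦ δc/2)` for the window graphs, the chain properties of every length `n ≤ nmax` at `(δ ↦ ε'')` for the habitat window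
graphs, the chain properties of every length at `(δr n ↦ δc)` for the window graphs, `Skel.RootOblTO … δr`, `Skelφ.FaceOblRO … δ₂` and
`Skel.ReachOblRHNO G nmax … δ` ⟹ `KSchA.KitAtRunO G S FD δ₂ ε''` — twin of `Skelφ.kitAtRun_of_oblRHO` (the `nmax = nmaxC` case).
[cite: KozmaNitzan2024, §4 (30), (32), Lemmas 10–12] -/
theorem kitAtRun_of_oblRHNO (hlip : Lip G φ) {nmax Δ' : ℕ} {δ δ₂ ε'' : ℝ} {δr : ℕ → ℝ} (hδc : S.δc ≤ δ)
    (hstep : ∀ (c : V) (Rπ : ℕ) (Wg : Sym2 V → unitInterval) (s : KNLevels.TStep (winGraph G c Rπ)), s.KitsAt Wg S.p Δ' δ₂ →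
      1 - δ₂ < (prodBernoulli Wg).real s.L.reachB → 1 - S.δc / 2 < (prodBernoulli Wg).real (⋃ t ∈ s.T, openConn s.L.o t))
    (hchain : ∀ n ≤ nmax, ∀ (Ω : Finset V) (Wg : Sym2 V → unitInterval) (s : Fin (n + 1) → KNLevels.TStep (winGraphIn G Ω))
      (T' : Fin (n + 1) → Finset V) (η : ℝ),
      (∀ i : Fin (n + 1), (s i).L.o = (s 0).L.o) →
      (∀ i : Fin n, T' (Fin.castSucc i) ⊆ (s i.succ).L.X 0) →
      (∀ i : Fin (n + 1), T' i ⊆ (s i).T) →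
      (∀ i : Fin (n + 1), (s i).KitsAt Wg S.p Δ' δ) →
      η ≤ δ / 2 →
      (∀ i : Fin (n + 1), (prodBernoulli Wg).real (⋃ t ∈ (s i).T \ T' i, openConn (s 0).L.o t) ≤ η) →
      1 - δ < (prodBernoulli Wg).real (s 0).L.reachB →
        1 - ε'' < (prodBernoulli Wg).real (⋃ t ∈ T' (Fin.last n), openConn (s 0).L.o t))
    (hchainr : ∀ (n : ℕ) (c : V) (Rπ : ℕ) (Wg : Sym2 V → unitInterval) (s : Fin (n + 1) → KNLevels.TStep (winGraph G c Rπ))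
      (T' : Fin (n + 1) → Finset V) (η : ℝ),
      (∀ i : Fin (n + 1), (s i).L.o = (s 0).L.o) →
      (∀ i : Fin n, T' (Fin.castSucc i) ⊆ (s i.succ).L.X 0) →
      (∀ i : Fin (n + 1), T' i ⊆ (s i).T) →
      (∀ i : Fin (n + 1), (s i).KitsAt Wg S.p Δ' (δr n)) →
      η ≤ δr n / 2 →
      (∀ i : Fin (n + 1), (prodBernoulli Wg).real (⋃ t ∈ (s i).T \ T' i, openConn (s 0).L.o t) ≤ η) →
      1 - δr n < (prodBernoulli Wg).real (s 0).L.reachB →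
        1 - S.δc < (prodBernoulli Wg).real (⋃ t ∈ T' (Fin.last n), openConn (s 0).L.o t))
    (hQ0 : RootOblTO G S Δ' δr) (hface : FaceOblRO G φ S FD Δ' δ₂) (hreach : ReachOblRHNO G nmax S FD Δ' δ) :
    KSchA.KitAtRunO G S FD δ₂ ε'' := by
  refine And.intro (Skel.rootObl_of_rootOblTO hchainr hQ0) (And.intro ?_ ?_)
  · intro h e hrun hc hV du hdu j hj o hsrc
    exact cond_of_faceOblAt hlip hstep (hface h e hrun hc hV du hdu j hj o) hsrc
  · intro h e hrun hc hV du hdu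
    exact Skel.reach_of_reachOblAtHNO hV hδc hchain (hreach h e hrun hc hV du hdu)

/-! ## §3 One chain accuracy for every length `≤ nmax` -/

variable (G) {Δ : ℕ} (hΔ : ∀ v, G.degree v ≤ Δ)

open KNLevels in
open KNLevels in
/-- **The chain property of every length `n ≤ nmax` at the accuracy `δCN nmax ε`**, in every subgraph `G' ≤ G`, for every `q < 1`, delivering
`1 − ε`. [cite: KozmaNitzan2024, §4 Lemma 12 (pp. 23–25)] -/
theorem δCN_specO {nmax : ℕ} {ε : ℝ} (hε : 0 < ε) {n : ℕ} (hn : n ≤ nmax) {q : unitInterval} (hq1 : (q : ℝ) < 1)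
    (G' : SimpleGraph V) [G'.LocallyFinite] (hG' : G' ≤ G) : ((∀ (Wt : Sym2 V → unitInterval) (s : Fin (n + 1) → TStep G') (T' : Fin (n + 1) → Finset V) (η : ℝ),
      (∀ i : Fin (n + 1), (s i).L.o = (s 0).L.o) →
      (∀ i : Fin n, T' (Fin.castSucc i) ⊆ (s i.succ).L.X 0) →
      (∀ i : Fin (n + 1), T' i ⊆ (s i).T) →
      (∀ i : Fin (n + 1), (s i).KitsAt Wt q Δ (δCN G hΔ nmax ε)) →
      η ≤ δCN G hΔ nmax ε / 2 →
      (∀ i : Fin (n + 1), (prodBernoulli Wt).real (⋃ t ∈ (s i).T \ T' i, openConn (s 0).L.o t) ≤ η) →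
      1 - δCN G hΔ nmax ε < (prodBernoulli Wt).real (s 0).L.reachB →
        1 - ε < (prodBernoulli Wt).real (⋃ t ∈ T' (Fin.last n), openConn (s 0).L.o t)) : Prop) := by
  intro Wt s T' η ho hlink hsub hkits hη hexc hsrc
  have hle := δCN_le_δUP G hΔ nmax ε hn
  exact δUP_specO G hΔ n hε q hq1 G' hG' Wt s T' η ho hlink hsub (fun i => (hkits i).mono hle) (hη.trans (by linarith)) hexc
    (by linarith)

end Skelφ

end Summit.CriticalPhenomena.PercolationContinuityZ3.Theorems.Transplant

end
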